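import Summits.Ventures.CertifiedManyBodySolver.Theorems.CovHg1201M19P10LeftEdgeOfKernelCertsRows
import Summits.Ventures.CertifiedManyBodySolver.Theorems.CovHg1201M19P10BottomOfKernelCertsRows
import HarnessLib
import HarnessLib.Audit

/-!
# Ventures/CertifiedManyBodySolver — Theorems/Hg1201M19P10StiffnessBoxCeilingOfKernelCertsQuad.lean: the rung leaf «MOS2-hg1201-M19P10»
# `Observables.Hg1201M19P10_StiffnessBoxCeiling` (route `CovHg1201M19P10`, HgBa₂CuO₄₊δ «Hg-1201» @10 GPa, n = 22/25 column) FROM FOUR KERNEL CERTIFICATES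
# IN THE «ROWS + HALVING» DESIGN OF RECORD ON ONE BOX GEOMETRY — the instance-facing LEAF target (cert-level twin of
# `Theorems/Hg1201M19P10StiffnessBoxCeilingOfKernelQuad.lean`)

HONEST FRAMING: ONE theorem, ONE term. Its hypotheses are of three kinds ONLY: (a) exporter DATA for FOUR vertices {P = hub at `(t′, U) = (−49/100, 3)`,
Q = U-spoke at `(−49/100, b)`, W = U-spoke at `(−49/100, 17/2)`, S = `t′`-spoke at `(−12/25, 3)`}, solve density `n₀ = 22/25`, the SAME corner objective
`−X₀(−49/100; Uo)` at all four, in hubbard-cov-la214-plan-1's design of record R-g4-5 ((N)-BY-ROWS + ADJOINT HALVING, `autoMasks`, box geometry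
`BoxGeom.boxQuot r R vmax`, ONE `Bkey`, ONE shared eom word list `EB`): per vertex EXACTLY the residue `TH hH TE hE TX hX μ ν κ cap κ′ fl K blocks CW hcw AV ns M
Cs hC0 Hs hchain hβ hsl` (one `ChainQAOK` kernel certificate + one `decide`-class inequality each); (b) `norm_num`-class literal checks — the two U-cells' and the
K2 pair's, VERBATIM from hubbard-cov-hg1201-box-1 g4's `covHg1201M19P10_PatchLeftEdgeP10_of_kernelCertsRowsTriple` and this seat's g4
`covHg1201M19P10_PatchBottomP10_of_kernelCertsRows` (p686662); (c) nothing else. THE HUB'S CERTIFICATE P SERVES BOTH the U-ladder {P, Q}, {Q, W} and the K2 `t′`-pair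
{P, S}: FOUR kernel certificates per column, not five. NO claim node, NO `@[conjecture]`, NO number of record is used or moved; NOTHING IS INSTANTIATED OR
EVALUATED HERE (no Hg-1201 exporter output exists — kit-side, not ordered; «no Lean proposal comes out of (β2)», captain 2026-08-29T01:28:51Z (b); targets in the
rev-9f design AS OF 2026-08-29, not re-cut here if it revs (a)); an eventual instance writes ONE `exact` against this theorem and THAT day's captain rules on what
it discharges. The closers of record (p676848, p666540) and the leaf of record p677463 over the WND / WN claim nodes are UNCHANGED; this file is SUPPORT PLUMBING,
never cited as a closer of record (captain STANDING CAUTION hubbard-obs STATUS l.4708 / l.4795 (vi); WORD l.4887); items stmt-Ventures-27104 / 27105 stay OPEN ·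
pen-HELD (α′); no hold / registry row (CTL 141, 153 / 154, 159–162) / tier / margin / box word moves; «closed modulo nodes» ≠ proved. Wording class (xx1): CONTROL / CALIBRATION
one-sided stiffness-scale ceiling of a downfolded screening-grade one-band Hg-1201-labelled box; a ceiling never speaks to `ρ_s = 0` / presence / `T_c` /
pairing / phase; columns certified separately — no pressure sentence; nothing about HgBa₂CuO₄₊δ samples; no summit statement is proved by this file.
ZERO compute, no definition, no `sorry`.

Cell `hubbard-obs` (D-0154 (1)(C) Hg-1201), seat hubbard-cov-hg1201-box-2 g5 (`prover-hubbard-cov-hg1201-box-2-g5-0`), typist / lineage desk.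
Proof = the route glue `Theses.CovHg1201M19P10.closes` applied to box-1 g4's left-edge cert-rows closer on {P, Q, W} and this seat's g4 bottom cert-rows closer on
{P, S} — the SAME P residue passed to both (binder types coincide literally, slope convention `sl = (μ 0 + μ 1)/2` on both sides).

References: T. Koma, H. Tasaki, J. Stat. Phys. 76 (1994) 745 §1 [KomaTasaki1994]; D. J. Scalapino, S. R. White, S.-C. Zhang, PRB 47 (1993) 7995 §II
[ScalapinoWhiteZhang1993]; J. Wang et al., PRX 14 (2024) 031006 §III [WangEtAl2024]; X. Han, S. A. Hartnoll, J. Kruthoff, PRL 125 (2020) 041601 §3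
[Han2020Bootstrap]; C. Jansson, D. Chaykin, C. Keil, SIAM J. Numer. Anal. 46 (2008) 180 [JanssonChaykinKeil2008]; S. Boyd, L. Vandenberghe,
*Convex Optimization* (2004) §5.9 [BoydVandenberghe2004].
-/

noncomputable section

namespace Summit.Ventures.CertifiedManyBodySolver.Theorems

open Summit.Ventures.CertifiedManyBodySolver.Downfold Summit.Ventures.CertifiedManyBodySolver
open Summit.Ventures.CertifiedManyBodySolver.Observables
open Summit.Ventures.CertifiedQuantumChemistry Summit.Ventures.CertifiedQuantumChemistry.CARPoly
open Summit.Ventures.CertifiedManyBodySolver.CARPolyWindow Summit.Ventures.CertifiedManyBodySolver.CARPolyWindow.BoxGeom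
open Literature.MathematicalPhysics.QuantumManyBody.StateRelaxation
open Literature.MathematicalPhysics.QuantumLattice Literature.MathematicalPhysics.QuantumLattice.ThermodynamicLimit
open Literature.Probability.LatticeModels
open Matrix Filter Topology HubbardWave0
open scoped BigOperators ComplexOrder

/-- **THE MO-S2 RUNG LEAF `Hg1201M19P10_StiffnessBoxCeiling` FROM FOUR KERNEL CERTIFICATES IN THE «ROWS + HALVING» DESIGN OF RECORD ON THE BOX GEOMETRY
`boxQuot r R vmax`** — vertices {P hub `(−49/100, 3)`, Q U-spoke `(−49/100, b)`, W U-spoke `(−49/100, 17/2)`, S `t′`-spoke `(−12/25, 3)`} at `n₀ = 22/25`,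
ONE `Bkey`, ONE shared `EB`, corner objective `Γ(incl)(−oddMomentObsTT (−49/100) Uo 0)` at all four: per vertex the instance supplies
`TH hH TE hE TX hX μ ν κ cap κ′ fl K blocks CW hcw AV ns M Cs hC0 Hs hchain hβ hsl` only; then the literal checks of the two left U-cells («PatchLeftEdgeP10» via
`covHg1201M19P10_PatchLeftEdgeP10_of_kernelCertsRowsTriple` on {P, Q, W}) and of the K2 pair («PatchBottomP10» via `covHg1201M19P10_PatchBottomP10_of_kernelCertsRows` on
{P, S}) — the hub certificate P serving both — and the route glue `closes`. Conclusion: the rung leaf — NO claim node; nothing instantiated in this file.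
[cite: Han2020Bootstrap, §3] [cite: WangEtAl2024, §III] [cite: JanssonChaykinKeil2008, §3] [cite: KomaTasaki1994, §1] [cite: ScalapinoWhiteZhang1993, §II]
[cite: BoydVandenberghe2004, §5.9] -/
theorem Hg1201M19P10_StiffnessBoxCeiling_of_kernelCertsQuad
    (b : ℚ) (hb₁ : 3 < b) (hb₂ : b < 17 / 2) (Uo : ℝ)
    (r R vmax : ℕ) (h7R : 7 ≤ R) (hrR : r + 1 ≤ R) (hvR : r + vmax ≤ R) (Bkey : ℕ)
    -- the SHARED eom words (inner window letters)
    (EB : List (Terms (Orb (Fin (boxN r)))))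
    -- vertex P (hub, `(t′, U) = (−49/100, 3)`) — serves the U-ladder AND the t′-pair
    (THP : Terms (Orb (Fin (boxN R))))
    (hHP : termOp (boxD R) THP =
      (hubbardTTPrimeFermionInteraction 1 (((-49 / 100 : ℚ)) : ℝ) (((3 : ℚ)) : ℝ)).localHamiltonian (boxW R))
    (TEP : Terms (Orb (Fin (boxN R))))
    (hEP : termOp (boxD R) TEP =
      fermionEmbed (PolySite.incl (thicken01_subset_boxW (le_trans (by norm_num) h7R)))
        ((hubbardTTPrimeFermionInteraction 1 (((-49 / 100 : ℚ)) : ℝ) (((3 : ℚ)) : ℝ)).meanEnergyObs 1))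
    (TXP : Terms (Orb (Fin (boxN R))))
    (hXP : termOp (boxD R) TXP = fermionEmbed (PolySite.incl (box_subset_boxW h7R)) (-oddMomentObsTT (-49 / 100) Uo 0))
    (μP : Fin 2 → ℚ) (νP κP capP κP' flP : ℚ) (KP : ℕ) (blocksP : List (List (List ℤ × Terms (Orb (Fin (boxN R))))))
    (CWP : Terms (Orb (Fin (boxN R)))) (hcwP : ∀ wc ∈ CWP, chargeW wc.1 ≠ 0 ∨ spinChargeW (fun a => (ofLex a).2) wc.1 ≠ 0)
    (AVP : List (Terms (Orb (Fin (boxN R)))))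
    (nsP : List ℕ) (MP : ℕ) (CsP : List SOSDual.EncPoly) (hC0P : CsP.getD 0 [] = []) (HsP : List (List (QHint (boxN r))))
    (hchainP : ChainQAOK (boxQuot r R vmax) Bkey MP CsP
      (groupSlices (residTGslicesNear TXP μP νP (fun σ => orb (boxIx R 0) σ) κP capP κP' flP TEP (gramTBRowsHalf KP blocksP) THP (boxPush r R) EB
        (autoMasks THP (boxPush r R) EB) (fun l : Fin 0 => l.elim0) (fun l : Fin 0 => l.elim0) CWP AVP) nsP) HsP)
    {βP : ℚ}
    (hβP : haveI := neZero_boxN R; βP ≤ lowerConst (SOSDual.decPoly (boxN R) (CsP.getD MP [])) + (μP 0 + μP 1) * ((22 / 25 : ℚ) / 2 - νP))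
    {slP : ℚ} (hslP : slP = (μP 0 + μP 1) / 2)
    -- vertex Q (U-spoke, `(−49/100, b)`)
    (THQ : Terms (Orb (Fin (boxN R))))
    (hHQ : termOp (boxD R) THQ =
      (hubbardTTPrimeFermionInteraction 1 (((-49 / 100 : ℚ)) : ℝ) ((b : ℚ) : ℝ)).localHamiltonian (boxW R))
    (TEQ : Terms (Orb (Fin (boxN R))))
    (hEQ : termOp (boxD R) TEQ =
      fermionEmbed (PolySite.incl (thicken01_subset_boxW (le_trans (by norm_num) h7R)))
        ((hubbardTTPrimeFermionInteraction 1 (((-49 / 100 : ℚ)) : ℝ) ((b : ℚ) : ℝ)).meanEnergyObs 1))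
    (TXQ : Terms (Orb (Fin (boxN R))))
    (hXQ : termOp (boxD R) TXQ = fermionEmbed (PolySite.incl (box_subset_boxW h7R)) (-oddMomentObsTT (-49 / 100) Uo 0))
    (μQ : Fin 2 → ℚ) (νQ κQ capQ κQ' flQ : ℚ) (KQ : ℕ) (blocksQ : List (List (List ℤ × Terms (Orb (Fin (boxN R))))))
    (CWQ : Terms (Orb (Fin (boxN R)))) (hcwQ : ∀ wc ∈ CWQ, chargeW wc.1 ≠ 0 ∨ spinChargeW (fun a => (ofLex a).2) wc.1 ≠ 0)
    (AVQ : List (Terms (Orb (Fin (boxN R)))))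
    (nsQ : List ℕ) (MQ : ℕ) (CsQ : List SOSDual.EncPoly) (hC0Q : CsQ.getD 0 [] = []) (HsQ : List (List (QHint (boxN r))))
    (hchainQ : ChainQAOK (boxQuot r R vmax) Bkey MQ CsQ
      (groupSlices (residTGslicesNear TXQ μQ νQ (fun σ => orb (boxIx R 0) σ) κQ capQ κQ' flQ TEQ (gramTBRowsHalf KQ blocksQ) THQ (boxPush r R) EB
        (autoMasks THQ (boxPush r R) EB) (fun l : Fin 0 => l.elim0) (fun l : Fin 0 => l.elim0) CWQ AVQ) nsQ) HsQ)
    {βQ : ℚ}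
    (hβQ : haveI := neZero_boxN R; βQ ≤ lowerConst (SOSDual.decPoly (boxN R) (CsQ.getD MQ [])) + (μQ 0 + μQ 1) * ((22 / 25 : ℚ) / 2 - νQ))
    {slQ : ℚ} (hslQ : slQ = (μQ 0 + μQ 1) / 2)
    -- vertex W (U-spoke, `(−49/100, 17/2)`)
    (THW : Terms (Orb (Fin (boxN R))))
    (hHW : termOp (boxD R) THW =
      (hubbardTTPrimeFermionInteraction 1 (((-49 / 100 : ℚ)) : ℝ) (((17 / 2 : ℚ)) : ℝ)).localHamiltonian (boxW R))
    (TEW : Terms (Orb (Fin (boxN R))))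
    (hEW : termOp (boxD R) TEW =
      fermionEmbed (PolySite.incl (thicken01_subset_boxW (le_trans (by norm_num) h7R)))
        ((hubbardTTPrimeFermionInteraction 1 (((-49 / 100 : ℚ)) : ℝ) (((17 / 2 : ℚ)) : ℝ)).meanEnergyObs 1))
    (TXW : Terms (Orb (Fin (boxN R))))
    (hXW : termOp (boxD R) TXW = fermionEmbed (PolySite.incl (box_subset_boxW h7R)) (-oddMomentObsTT (-49 / 100) Uo 0))
    (μW : Fin 2 → ℚ) (νW κW capW κW' flW : ℚ) (KW : ℕ) (blocksW : List (List (List ℤ × Terms (Orb (Fin (boxN R))))))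
    (CWW : Terms (Orb (Fin (boxN R)))) (hcwW : ∀ wc ∈ CWW, chargeW wc.1 ≠ 0 ∨ spinChargeW (fun a => (ofLex a).2) wc.1 ≠ 0)
    (AVW : List (Terms (Orb (Fin (boxN R)))))
    (nsW : List ℕ) (MW : ℕ) (CsW : List SOSDual.EncPoly) (hC0W : CsW.getD 0 [] = []) (HsW : List (List (QHint (boxN r))))
    (hchainW : ChainQAOK (boxQuot r R vmax) Bkey MW CsW
      (groupSlices (residTGslicesNear TXW μW νW (fun σ => orb (boxIx R 0) σ) κW capW κW' flW TEW (gramTBRowsHalf KW blocksW) THW (boxPush r R) EB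
        (autoMasks THW (boxPush r R) EB) (fun l : Fin 0 => l.elim0) (fun l : Fin 0 => l.elim0) CWW AVW) nsW) HsW)
    {βW : ℚ}
    (hβW : haveI := neZero_boxN R; βW ≤ lowerConst (SOSDual.decPoly (boxN R) (CsW.getD MW [])) + (μW 0 + μW 1) * ((22 / 25 : ℚ) / 2 - νW))
    {slW : ℚ} (hslW : slW = (μW 0 + μW 1) / 2)
    -- vertex S (t′-spoke, `(−12/25, 3)`)
    (THS : Terms (Orb (Fin (boxN R))))
    (hHS : termOp (boxD R) THS =
      (hubbardTTPrimeFermionInteraction 1 (((-12 / 25 : ℚ)) : ℝ) (((3 : ℚ)) : ℝ)).localHamiltonian (boxW R))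
    (TES : Terms (Orb (Fin (boxN R))))
    (hES : termOp (boxD R) TES =
      fermionEmbed (PolySite.incl (thicken01_subset_boxW (le_trans (by norm_num) h7R)))
        ((hubbardTTPrimeFermionInteraction 1 (((-12 / 25 : ℚ)) : ℝ) (((3 : ℚ)) : ℝ)).meanEnergyObs 1))
    (TXS : Terms (Orb (Fin (boxN R))))
    (hXS : termOp (boxD R) TXS = fermionEmbed (PolySite.incl (box_subset_boxW h7R)) (-oddMomentObsTT (-49 / 100) Uo 0))
    (μS : Fin 2 → ℚ) (νS κS capS κS' flS : ℚ) (KS : ℕ) (blocksS : List (List (List ℤ × Terms (Orb (Fin (boxN R))))))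
    (CWS : Terms (Orb (Fin (boxN R)))) (hcwS : ∀ wc ∈ CWS, chargeW wc.1 ≠ 0 ∨ spinChargeW (fun a => (ofLex a).2) wc.1 ≠ 0)
    (AVS : List (Terms (Orb (Fin (boxN R)))))
    (nsS : List ℕ) (MS : ℕ) (CsS : List SOSDual.EncPoly) (hC0S : CsS.getD 0 [] = []) (HsS : List (List (QHint (boxN r))))
    (hchainS : ChainQAOK (boxQuot r R vmax) Bkey MS CsS
      (groupSlices (residTGslicesNear TXS μS νS (fun σ => orb (boxIx R 0) σ) κS capS κS' flS TES (gramTBRowsHalf KS blocksS) THS (boxPush r R) EB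
        (autoMasks THS (boxPush r R) EB) (fun l : Fin 0 => l.elim0) (fun l : Fin 0 => l.elim0) CWS AVS) nsS) HsS)
    {βS : ℚ}
    (hβS : haveI := neZero_boxN R; βS ≤ lowerConst (SOSDual.decPoly (boxN R) (CsS.getD MS [])) + (μS 0 + μS 1) * ((22 / 25 : ℚ) / 2 - νS))
    {slS : ℚ} (hslS : slS = (μS 0 + μS 1) / 2)
    -- multiplier signs and cut floors
    (hκP : 0 ≤ κP) (hκP' : 0 ≤ κP') (hκQ : 0 ≤ κQ) (hκQ' : 0 ≤ κQ') (hκW : 0 ≤ κW) (hκW' : 0 ≤ κW') (hκS : 0 ≤ κS) (hκS' : 0 ≤ κS')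
    (hflP : flP ≤ -124827703/50000000) (hflQ : flQ ≤ -124827703/50000000) (hflW : flW ≤ -124827703/50000000)
    -- «PatchLeftEdgeP10» cell 1 = {P, Q} re-priced to the top-plane values `cP♯`, `cQ♯`: bounds, law, slot, prices
    {cPs cQs βPs βQs F₁ L₁ : ℚ}
    (hcPs : cPs = -15830689/10000000 + 3 * (121/625)) (hcQs : cQs = -15830689/10000000 + b * (121/625))
    (hβPs : βPs ≤ βP - κP * (cPs - capP)) (hβQs : βQs ≤ βQ - κQ * (cQs - capQ))
    (hL₁ : ((L₁ : ℚ) : ℝ) = (((b : ℚ) : ℝ) - 3) * max ((((κQ - κP) - (κQ' - κP') : ℚ) : ℝ) * 0)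
        ((((κQ - κP) - (κQ' - κP') : ℚ) : ℝ) * (((1 / 4 : ℚ)) : ℝ)) -
          ((((κQ - κP) * (cQs - cPs) + (κQ' - κP') * (-(flQ - flP)) : ℚ)) : ℝ))
    (hF₁v : L₁ ≤ 0 → F₁ ≤ min βPs βQs)
    (hF₁i : 0 < L₁ → ((F₁ : ℚ) : ℝ) ≤ ((βPs : ℚ) : ℝ) - (((L₁ : ℚ) : ℝ) - (((βQs : ℚ) : ℝ) - ((βPs : ℚ) : ℝ))) ^ 2 / (4 * ((L₁ : ℚ) : ℝ)))
    (p₀ : -F₁ ≤ 4767609 / 10000000) (p₁ : -F₁ - slP * (43 / 50 - 22 / 25) ≤ 4767609 / 10000000)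
    (p₂ : -F₁ - slQ * (43 / 50 - 22 / 25) ≤ 4767609 / 10000000)
    -- «PatchLeftEdgeP10» cell 2 = {Q, W} re-priced to the polarised constant `c`: bounds, law, slot, prices
    {c βQc βWc F₂ L₂ : ℚ} (hc₁ : (-6148940299/10000000000 : ℚ) ≤ c) (hc₂ : (-5511249107/10000000000 : ℚ) ≤ c)
    (hcU : ((c : ℚ) : ℝ) + 15861979 / 10000000 ≤ ((b : ℚ) : ℝ) / 4)
    (hβQc : βQc ≤ βQ - κQ * (c - capQ)) (hβWc : βWc ≤ βW - κW * (c - capW))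
    (hL₂ : ((L₂ : ℚ) : ℝ) = (17 / 2 - ((b : ℚ) : ℝ)) * max ((((κW - κQ) - (κW' - κQ') : ℚ) : ℝ) * 0)
        ((((κW - κQ) - (κW' - κQ') : ℚ) : ℝ) * (((1 / 4 : ℚ)) : ℝ)) -
          ((((κW - κQ) * (c - c) + (κW' - κQ') * (-(flW - flQ)) : ℚ)) : ℝ))
    (hF₂v : L₂ ≤ 0 → F₂ ≤ min βQc βWc)
    (hF₂i : 0 < L₂ → ((F₂ : ℚ) : ℝ) ≤ ((βQc : ℚ) : ℝ) - (((L₂ : ℚ) : ℝ) - (((βWc : ℚ) : ℝ) - ((βQc : ℚ) : ℝ))) ^ 2 / (4 * ((L₂ : ℚ) : ℝ)))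
    (q₀ : -F₂ ≤ 4767609 / 10000000) (q₁ : -F₂ - slQ * (43 / 50 - 22 / 25) ≤ 4767609 / 10000000)
    (q₂ : -F₂ - slW * (43 / 50 - 22 / 25) ≤ 4767609 / 10000000)
    -- «PatchBottomP10» = the t′-pair {P, S}: re-keyed bounds (cap plane of record / kinematic floor), the chord law's `L`, the floor kind, three prices
    {βPt βSt F₃ L₃ : ℚ}
    (hβPt : βPt ≤ βP - κP * ((-10022689/10000000 : ℚ) - capP) - κP' * (flP - (-124827703/50000000)))
    (hβSt : βSt ≤ βS - κS * ((-1250541281/1250000000 : ℚ) - capS) - κS' * (flS - (-124827703/50000000)))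
    (hL₃ : (16211390 / 10000000 : ℚ) * (1 / 100) * ((κP - κP') - (κS - κS')) - (κS - κP) * (573711/312500000) ≤ L₃)
    (hL₃' : (16211390 / 10000000 : ℚ) * (1 / 100) * -((κP - κP') - (κS - κS')) - (κS - κP) * (573711/312500000) ≤ L₃)
    (hkind₃ : (0 ≤ L₃ ∧ βPt + L₃ ≤ βSt ∧ F₃ ≤ βPt) ∨ (0 ≤ L₃ ∧ βSt + L₃ ≤ βPt ∧ F₃ ≤ βSt) ∨
      (0 < L₃ ∧ F₃ ≤ βPt - (L₃ - (βSt - βPt)) ^ 2 / (4 * L₃)))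
    (r₀ : -F₃ ≤ 4767609 / 10000000) (r₁ : -F₃ - slP * (43 / 50 - 22 / 25) ≤ 4767609 / 10000000)
    (r₂ : -F₃ - slS * (43 / 50 - 22 / 25) ≤ 4767609 / 10000000) :
    Hg1201M19P10_StiffnessBoxCeiling :=
  -- the route glue on (left edge from {P, Q, W}) and (bottom from {P, S}) — the SAME hub certificate P in both
  Summit.Ventures.CertifiedManyBodySolver.Theses.CovHg1201M19P10.closes
    (covHg1201M19P10_PatchLeftEdgeP10_of_kernelCertsRowsTriple b hb₁ hb₂ Uo r R vmax h7R hrR hvR Bkey EB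
      THP hHP TEP hEP TXP hXP μP νP κP capP κP' flP KP blocksP CWP hcwP AVP nsP MP CsP hC0P HsP hchainP hβP hslP
      THQ hHQ TEQ hEQ TXQ hXQ μQ νQ κQ capQ κQ' flQ KQ blocksQ CWQ hcwQ AVQ nsQ MQ CsQ hC0Q HsQ hchainQ hβQ hslQ
      THW hHW TEW hEW TXW hXW μW νW κW capW κW' flW KW blocksW CWW hcwW AVW nsW MW CsW hC0W HsW hchainW hβW hslW
      hκP hκP' hκQ hκQ' hκW hκW' hflP hflQ hflW
      hcPs hcQs hβPs hβQs hL₁ hF₁v hF₁i p₀ p₁ p₂ hc₁ hc₂ hcU hβQc hβWc hL₂ hF₂v hF₂i q₀ q₁ q₂)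
    (covHg1201M19P10_PatchBottomP10_of_kernelCertsRows Uo r R vmax h7R hrR hvR Bkey EB
      THP hHP TEP hEP TXP hXP μP νP κP capP κP' flP KP blocksP CWP hcwP AVP nsP MP CsP hC0P HsP hchainP hβP hslP
      THS hHS TES hES TXS hXS μS νS κS capS κS' flS KS blocksS CWS hcwS AVS nsS MS CsS hC0S HsS hchainS hβS hslS
      hκP hκP' hκS hκS' hβPt hβSt hL₃ hL₃' hkind₃ r₀ r₁ r₂)

end Summit.Ventures.CertifiedManyBodySolver.Theorems

end
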